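import Summits.CriticalPhenomena.PercolationContinuityZ3.Theorems.PercNearOneGluingNoHeavyLowerTailSahiTwoLevelSaturation
import Summits.CriticalPhenomena.PercolationContinuityZ3.Theorems.PercNearOneGluingNoHeavyLowerTailSahiClassTSingleCube
import Mathlib.Tactic.Linarith
import HarnessLib

/-!
# Kahn's inequality on the saturation-certified class, II: CLASS T as a base case of the recursion

Support file of the one-cut programme (crux `NoHeavyLowerTail`, stmt-CriticalPhenomena-4575; master-family line P2 = Sahi's algebraic route,
seat `prim-masterthm-p2` gen 22; memo `run/shared/lean/prim/prim-masterthm/FROM-prim-masterthm-p2-g22-SATURATION.md` §1–§3).  No definition, no sorry;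
axioms standard.

`…SahiTwoLevelSaturation.sahiE3_nonneg_of_recursivelySaturated` proves `E_3(μ_q; U) ≥ 0` on every class of increasing triples certified recursively by {absorbing head |
two members on coordinate sets sharing ≤ 1 coin | inessential coordinate | a coordinate whose pair of sections reaches, by the monotone moves of `T⁺`, a bias-free face}.
Here one more exit is added: **(t) CLASS T — no coordinate essential to all three members** — discharged by lane P2's triangle-class theorem
(`SahiClassTCube.sahiE_three_nonneg_of_classT'`, gen 8/14: Sahi's `C_3` on the whole class T, every product measure).  The least class so certified, `K_satT`, is
where the programme's coordinate induction currently stands; its complement begins on FOUR coins with a single `S_4`-orbit (memo §3):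
`U_i = (x_a ∨ x_b) ∧ (x_c ∨ x_d)` for the three perfect matchings `{ab | cd}` — "ω contains an edge of the 4-cycle `K_4 ∖ M_i`", the co-sunflower of the petals
`x_ax_b ∨ x_cx_d`; at every coordinate its sections are the co-sunflower tops `x_j ∨ x_k` over the petal-gated bottoms `x_i(x_j ∨ x_k)`, outside every bias-free face, with a
trivial move closure (`T⁺ = 25/128` at `q ≡ ½`, comb-positive).  EXHAUSTIVE CENSUS on the saturated triples (3-coloured antichains, prim-sahi's reduction
`SahiAbsorbed.sahiPositive_three_of_colouring`): 4-cube 6 484 — the least class of THIS theorem (`K_satT`) certifies all but that one orbit; 5-cube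
4 061 113 — all but 62 400 coloured antichains (10 400 triples, 127 `S_5 × S_3`-orbits; 1.54 %); with the Kahn side conditions of the step granted (the
inductive step `Kahn(4) ⟹ Kahn(5)` alone) all but 7 990 triples in 88 orbits.  The remaining orbits are ALL certified by TYPE-LEVEL certificates
(`…SahiTwoLevelMonomialFace`: `T⁺ − E_3(G)` monomial-positive in the type masses on the co-sunflower-tops face, which contains the `K_4` orbit; and 197
LP-found Kahn+Harris+monomial identities — memo §5), so that on ≤ 5 coins the induction is certified pattern by pattern.  HONEST LABEL: Kahn's Conjecture 5 /
`SahiTwoLevelPlus` OPEN. [this work]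
-/

noncomputable section

open scoped Classical

namespace Summit.CriticalPhenomena.PercolationContinuityZ3.Theorems

namespace SahiTwoLevelVariational

open Finset Function MeasureTheory
open Literature.Combinatorics.Sahi2008
open Literature.Probability.LatticeModels (prodBernoulli prodBernoulli_harris sahiE3 sahiE3_def)
open Literature.Probability.Percolation (DeterminedBy determinedBy_iff)
open Literature.Probability.Percolation.DecisionTree (ind ind_of_mem ind_of_not_mem ind_nonneg)

variable {κ : Type} [Fintype κ]

/-- **KAHN'S INEQUALITY ON EVERY SATURATION-CERTIFIED CLASS, WITH CLASS T AS A BASE CASE.**  As `sahiE3_nonneg_of_recursivelySaturated`, with one more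
exit: (t) no coordinate is essential to all three members (`SahiClassTCube.sahiE_three_nonneg_of_classT'`, lane P2 gen 8/14 — Sahi's `C_3` on the whole triangle class).
CENSUS of the least such class `K_satT` on the SATURATED triples (3-coloured antichains; prim-sahi's reduction): 4-cube — all 6 484 but ONE orbit, the three 4-cycles of `K₄`
`U_i = (x_a ∨ x_b)(x_c ∨ x_d)`; 5-cube — 3 998 713 of 4 061 113 (the inductive step alone, side conditions granted: all but 7 990 triples in 88 orbits, all of which carry
type-level certificates — memo §5). [this work] -/
theorem sahiE3_nonneg_of_recursivelySaturatedT (q : κ → unitInterval) (P : Finset κ → (Fin 3 → Set (Set κ)) → Prop)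
    (hP : ∀ (S : Finset κ) (U : Fin 3 → Set (Set κ)), P S U →
      (∃ i : Fin 3, ∀ ω : Set κ, (∀ k : Fin 3, k ≠ i → ω ∈ U k) → ω ∈ U i)
      ∨ (∃ T₀ T₁ : Finset κ, (T₀ ∩ T₁).card ≤ 1 ∧
          ((DeterminedBy (U 0) (↑T₀ : Set κ) ∧ DeterminedBy (U 1) (↑T₁ : Set κ))
            ∨ (DeterminedBy (U 1) (↑T₀ : Set κ) ∧ DeterminedBy (U 2) (↑T₁ : Set κ))
            ∨ (DeterminedBy (U 0) (↑T₀ : Set κ) ∧ DeterminedBy (U 2) (↑T₁ : Set κ))))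
      ∨ (∀ x, ¬ (x ∈ esupp (U 0) ∧ x ∈ esupp (U 1) ∧ x ∈ esupp (U 2)))
      ∨ (∃ e ∈ S, (∀ i, DeterminedBy (U i) (↑(S.erase e) : Set κ)) ∧ P (S.erase e) U)
      ∨ (∃ e ∈ S, ∃ G' H' : Fin 3 → Set (Set κ),
          Reaches ![secAt e true (U 0), secAt e true (U 1), secAt e true (U 2)]
              ![secAt e false (U 0), secAt e false (U 1), secAt e false (U 2)] G' H'
          ∧ (∀ i, DeterminedBy (G' i) (↑(S.erase e) : Set κ) ∧ DeterminedBy (H' i) (↑(S.erase e) : Set κ))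
          ∧ P (S.erase e) ![secAt e true (U 0), secAt e true (U 1), secAt e true (U 2)]
          ∧ P (S.erase e) ![secAt e false (U 0), secAt e false (U 1), secAt e false (U 2)]
          ∧ SatFace P (S.erase e) G' H')) :
    ∀ (S : Finset κ) (U : Fin 3 → Set (Set κ)), P S U → (∀ i, IsUpperSet (U i)) → (∀ i, DeterminedBy (U i) (↑S : Set κ)) →
      0 ≤ sahiE3 (prodBernoulli q) (U 0) (U 1) (U 2) := by
  -- Absorb exit (t) into the predicate: run the move recursion on `P' S U := P S U`, discharging class T directly where it occurs.
  suffices key : ∀ (m : ℕ) (S : Finset κ) (U : Fin 3 → Set (Set κ)), S.card = m → P S U → (∀ i, IsUpperSet (U i)) →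
      (∀ i, DeterminedBy (U i) (↑S : Set κ)) → 0 ≤ sahiE3 (prodBernoulli q) (U 0) (U 1) (U 2) from
    fun S U hPU hU hUS => key _ S U rfl hPU hU hUS
  intro m
  induction m using Nat.strong_induction_on with
  | _ m ih =>
  intro S U hS hPU hU hUS
  rcases hP S U hPU with ⟨i, hi⟩ | ⟨T₀, T₁, hT, hdet⟩ | hT | ⟨e, heS, hdet, hPe⟩ | ⟨e, heS, G', H', hR, hdet', hP1, hP0, hface⟩
  · refine SahiAbsorbed.kahn_sahiE3_nonneg_of_inter_subset q (U 0) (U 1) (U 2) (hU 0) (hU 1) (hU 2) i fun ω hω => ?_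
    have h := hi ω fun k hk => by
      have := hω k hk
      fin_cases k <;> simpa using this
    fin_cases i <;> simpa using h
  · exact sahiE3_nonneg_of_sharedLeOne q U hU T₀ T₁ hT hdet
  · -- (t) class T
    have h := SahiClassTCube.sahiE_three_nonneg_of_classT' U hU hT q
    have e3 : (fun i => ind (U i)) = ![ind (U 0), ind (U 1), ind (U 2)] := by
      funext i; fin_cases i <;> rfl
    rw [e3, sahiE_three_ind] at h
    exact h
  · have hlt : (S.erase e).card < m := by rw [← hS]; exact Finset.card_erase_lt_of_mem heS
    exact ih _ hlt (S.erase e) U rfl hPe hU hdet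
  · have hlt : (S.erase e).card < m := by rw [← hS]; exact Finset.card_erase_lt_of_mem heS
    set G : Fin 3 → Set (Set κ) := ![secAt e true (U 0), secAt e true (U 1), secAt e true (U 2)] with hGdef
    set H : Fin 3 → Set (Set κ) := ![secAt e false (U 0), secAt e false (U 1), secAt e false (U 2)] with hHdef
    have hGup : ∀ i, IsUpperSet (G i) := fun i => by
      rw [hGdef, secTriple_apply]; exact isUpperSet_secAt e true (hU i)
    have hHup : ∀ i, IsUpperSet (H i) := fun i => by
      rw [hHdef, secTriple_apply]; exact isUpperSet_secAt e false (hU i)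
    have hHG : ∀ i, H i ⊆ G i := fun i => by
      rw [hGdef, hHdef, secTriple_apply, secTriple_apply]; exact SahiTwoLevel.secAt_false_subset_true e (hU i)
    have hN : NestedUp G H := ⟨hGup, hHup, hHG⟩
    have hN' : NestedUp G' H' := nestedUp_of_reaches hR hN
    have h1 : 0 ≤ sahiE3 (prodBernoulli q) (secAt e true (U 0)) (secAt e true (U 1)) (secAt e true (U 2)) := by
      have := ih _ hlt (S.erase e) G rfl hP1 hGup
        (fun i => by rw [hGdef, secTriple_apply]; exact determinedBy_secAt e true (hUS i))
      simpa [hGdef] using this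
    have h0 : 0 ≤ sahiE3 (prodBernoulli q) (secAt e false (U 0)) (secAt e false (U 1)) (secAt e false (U 2)) := by
      have := ih _ hlt (S.erase e) H rfl hP0 hHup
        (fun i => by rw [hHdef, secTriple_apply]; exact determinedBy_secAt e false (hUS i))
      simpa [hHdef] using this
    have hKahn : ∀ X : Fin 3 → Set (Set κ), (∀ i, X i = G' i ∨ X i = H' i) → P (S.erase e) X →
        0 ≤ sahiE3 (prodBernoulli q) (X 0) (X 1) (X 2) := by
      intro X hX hPX
      have hup : ∀ i, IsUpperSet (X i) := by
        intro i; rcases hX i with h | h <;> rw [h]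
        · exact hN'.1 i
        · exact hN'.2.1 i
      have hdet : ∀ i, DeterminedBy (X i) (↑(S.erase e) : Set κ) := by
        intro i; rcases hX i with h | h <;> rw [h]
        · exact (hdet' i).1
        · exact (hdet' i).2
      exact ih _ hlt (S.erase e) X rfl hPX hup hdet
    have hT' : 0 ≤ topForm q G' H' := topForm_nonneg_of_satFace q P (S.erase e) G' H' hN' hKahn hface
    have hT : 0 ≤ topForm q G H := hT'.trans (topForm_le_of_reaches q hR hN)
    exact sahiE3_nonneg_of_topForm_secAt_nonneg q e (hU 0) (hU 1) (hU 2) hT h0 h1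


end SahiTwoLevelVariational

end Summit.CriticalPhenomena.PercolationContinuityZ3.Theorems
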